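import Literature.MathematicalPhysics.QuantumFieldTheory.ConformalBootstrap3D.PointKernelScover

/-!
# Point-functional kernel: head cells with the INTERVAL coefficient rule

`PointKernel`'s head-cell checkers (`cellOK`, `cellOKC`) bound the Hogervorst–Rychkov coefficients
`A_{n,j}(Δ)` on a cell `[a, b]` by the MONOTONE rule — `A_{n,j}` evaluated at both end points,
valid for cells starting at `a ≥ ℓ + 1` (`hrCoeff_mem_Icc_cell`).  The `ε`-row of a LOWER box of the
`σ–ε` system (`ℓ = 0`, `Δ_ε ∈ [0.6, 1)`) starts below `1`, where `A_{2,0}(Δ) = Δ(Δ-1)²/(24(Δ-½))`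
is not monotone; there the table theorem `boxExcluded_of_pointTable₂` offers the INTERVAL rule
(`headNumber₂ … useInterval = true`, `headCellSumI`: summand `min(Lo·Φ, Hi·Φ)` with the two-sided
enclosure `hrCoeffLo ≤ A_{n,j}(Δ) ≤ hrCoeffHi` of `HRCoeffIntervalBounds`, valid for `a > ½` at
`ℓ = 0`).  This file adds the matching kernel pieces, WITHOUT touching the landed checkers:

* rational mirrors `hrCoeffLoQ` / `hrCoeffHiQ` of the interval tables (`cast_hrCoeffLoQ/HiQ`), row
  lists `hrRowListLo/Hi`;
* the interval corner / chord cell checkers `PCert.cellOKI` / `PCert.cellOKCI` — the landed summand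
  functions `qLo` / `qLoC` fed with the interval rows in place of `(A(a)ρ, A(b)ρ')` — and their
  soundness `cell_soundI` / `cell_soundCI` (`0 ≤ headNumberI …`);
* segment / block checkers `hSegOKI`, `hBlockOKI` over the same `HSeg` data, delivering
  `PCert.CellFactI`, and the `s`-covered form `PCert.CellFactIS` with the piece-certificate glue
  (`CellFactI_withS`, `CellFactIS_of_pieces`) exactly as in `PointKernelScover`.

[cite: HogervorstRychkov2013, §3 eq. (3.9)]
-/

namespace Literature.MathematicalPhysics.QuantumFieldTheory.ConformalBootstrap3D

namespace PointKernel

open Literature.Analysis.ValidatedNumerics (rsum rall vget vtab vget_vtab vget_of_length_le rsum_eq_sum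
  rall_eq_true_iff of_rall)
open Literature.Analysis.ValidatedNumerics.NumericsMP
open Real Finset

/-! ### The interval tables over `ℚ` -/

/-- `sqLower` over `ℚ`. [folklore] -/
def sqLowerQ (u v : ℚ) : ℚ := if u ≤ 0 ∧ 0 ≤ v then 0 else min (u ^ 2) (v ^ 2)

/-- `sqUpper` over `ℚ`. [folklore] -/
def sqUpperQ (u v : ℚ) : ℚ := max (u ^ 2) (v ^ 2)

/-- [folklore] -/
theorem cast_sqLowerQ (u v : ℚ) : ((sqLowerQ u v : ℚ) : ℝ) = sqLower (u : ℝ) (v : ℝ) := by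
  unfold sqLowerQ sqLower
  by_cases h : u ≤ 0 ∧ 0 ≤ v
  · have h' : ((u : ℚ) : ℝ) ≤ 0 ∧ (0 : ℝ) ≤ ((v : ℚ) : ℝ) := ⟨by exact_mod_cast h.1, by exact_mod_cast h.2⟩
    rw [if_pos h, if_pos h']
    simp
  · have h' : ¬ (((u : ℚ) : ℝ) ≤ 0 ∧ (0 : ℝ) ≤ ((v : ℚ) : ℝ)) := by
      rintro ⟨h1, h2⟩
      exact h ⟨by exact_mod_cast h1, by exact_mod_cast h2⟩
    rw [if_neg h, if_neg h']
    push_cast [Rat.cast_min]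
    rfl

/-- [folklore] -/
theorem cast_sqUpperQ (u v : ℚ) : ((sqUpperQ u v : ℚ) : ℝ) = sqUpper (u : ℝ) (v : ℝ) := by
  unfold sqUpperQ sqUpper
  push_cast [Rat.cast_max]
  rfl

/-- `hrGammaPlusLo` over `ℚ`. [cite: HogervorstRychkov2013, §3 eq. (3.8)] -/
def hrGammaPlusLoQ (E₁ E₂ : ℚ) (j : ℕ) : ℚ :=
  sqLowerQ (E₁ + (j : ℚ)) (E₂ + (j : ℚ)) * ((j : ℚ) + 1) / (2 * (j : ℚ) + 1)

/-- `hrGammaPlusHi` over `ℚ`. [cite: HogervorstRychkov2013, §3 eq. (3.8)] -/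
def hrGammaPlusHiQ (E₁ E₂ : ℚ) (j : ℕ) : ℚ :=
  sqUpperQ (E₁ + (j : ℚ)) (E₂ + (j : ℚ)) * ((j : ℚ) + 1) / (2 * (j : ℚ) + 1)

/-- `hrGammaMinusLo` over `ℚ`. [cite: HogervorstRychkov2013, §3 eq. (3.8)] -/
def hrGammaMinusLoQ (E₁ E₂ : ℚ) (j : ℕ) : ℚ :=
  sqLowerQ (E₁ - (j : ℚ) - 1) (E₂ - (j : ℚ) - 1) * (j : ℚ) / (2 * (j : ℚ) + 1)

/-- `hrGammaMinusHi` over `ℚ`. [cite: HogervorstRychkov2013, §3 eq. (3.8)] -/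
def hrGammaMinusHiQ (E₁ E₂ : ℚ) (j : ℕ) : ℚ :=
  sqUpperQ (E₁ - (j : ℚ) - 1) (E₂ - (j : ℚ) - 1) * (j : ℚ) / (2 * (j : ℚ) + 1)

/-- [folklore] -/
theorem cast_hrGammaPlusLoQ (E₁ E₂ : ℚ) (j : ℕ) :
    ((hrGammaPlusLoQ E₁ E₂ j : ℚ) : ℝ) = hrGammaPlusLo (E₁ : ℝ) (E₂ : ℝ) j := by
  unfold hrGammaPlusLoQ hrGammaPlusLo
  push_cast [cast_sqLowerQ]
  ring_nf

/-- [folklore] -/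
theorem cast_hrGammaPlusHiQ (E₁ E₂ : ℚ) (j : ℕ) :
    ((hrGammaPlusHiQ E₁ E₂ j : ℚ) : ℝ) = hrGammaPlusHi (E₁ : ℝ) (E₂ : ℝ) j := by
  unfold hrGammaPlusHiQ hrGammaPlusHi
  push_cast [cast_sqUpperQ]
  ring_nf

/-- [folklore] -/
theorem cast_hrGammaMinusLoQ (E₁ E₂ : ℚ) (j : ℕ) :
    ((hrGammaMinusLoQ E₁ E₂ j : ℚ) : ℝ) = hrGammaMinusLo (E₁ : ℝ) (E₂ : ℝ) j := by
  unfold hrGammaMinusLoQ hrGammaMinusLo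
  push_cast [cast_sqLowerQ]
  ring_nf

/-- [folklore] -/
theorem cast_hrGammaMinusHiQ (E₁ E₂ : ℚ) (j : ℕ) :
    ((hrGammaMinusHiQ E₁ E₂ j : ℚ) : ℝ) = hrGammaMinusHi (E₁ : ℝ) (E₂ : ℝ) j := by
  unfold hrGammaMinusHiQ hrGammaMinusHi
  push_cast [cast_sqUpperQ]
  ring_nf

/-- One step of the LOWER interval recursion on a tabulated level (pivot at `Δ₂`).
[cite: HogervorstRychkov2013, §3 eq. (3.9)] -/
def hrStepLoQ (Δ₁ Δ₂ : ℚ) (ℓ n : ℕ) (row : List ℚ) (j : ℕ) : ℚ :=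
  if InDescendantRange ℓ (n + 1) j then
    ((if j = 0 then 0 else hrGammaPlusLoQ (Δ₁ + n) (Δ₂ + n) (j - 1) * vget row (j - 1)) +
        hrGammaMinusLoQ (Δ₁ + n) (Δ₂ + n) (j + 1) * vget row (j + 1)) /
      casimirPivotQ Δ₂ ℓ (n + 1) j
  else 0

/-- One step of the UPPER interval recursion on a tabulated level (pivot at `Δ₁`).
[cite: HogervorstRychkov2013, §3 eq. (3.9)] -/
def hrStepHiQ (Δ₁ Δ₂ : ℚ) (ℓ n : ℕ) (row : List ℚ) (j : ℕ) : ℚ :=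
  if InDescendantRange ℓ (n + 1) j then
    ((if j = 0 then 0 else hrGammaPlusHiQ (Δ₁ + n) (Δ₂ + n) (j - 1) * vget row (j - 1)) +
        hrGammaMinusHiQ (Δ₁ + n) (Δ₂ + n) (j + 1) * vget row (j + 1)) /
      casimirPivotQ Δ₁ ℓ (n + 1) j
  else 0

/-- Level `n` of the lower interval table as a list (`j = 0, …, ℓ + n`).
[cite: HogervorstRychkov2013, §3 eq. (3.9)] -/
def hrRowLoQ (Δ₁ Δ₂ : ℚ) (ℓ : ℕ) : ℕ → List ℚ
  | 0 => vtab (ℓ + 1) fun j => if j = ℓ then 1 else 0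
  | n + 1 => vtab (ℓ + n + 2) (hrStepLoQ Δ₁ Δ₂ ℓ n (hrRowLoQ Δ₁ Δ₂ ℓ n))

/-- Level `n` of the upper interval table as a list. [cite: HogervorstRychkov2013, §3 eq. (3.9)] -/
def hrRowHiQ (Δ₁ Δ₂ : ℚ) (ℓ : ℕ) : ℕ → List ℚ
  | 0 => vtab (ℓ + 1) fun j => if j = ℓ then 1 else 0
  | n + 1 => vtab (ℓ + n + 2) (hrStepHiQ Δ₁ Δ₂ ℓ n (hrRowHiQ Δ₁ Δ₂ ℓ n))

/-- `hrCoeffLo` over `ℚ` (read off the tabulated level). [cite: HogervorstRychkov2013, §3 eq. (3.9)] -/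
def hrCoeffLoQ (Δ₁ Δ₂ : ℚ) (ℓ n j : ℕ) : ℚ := vget (hrRowLoQ Δ₁ Δ₂ ℓ n) j

/-- `hrCoeffHi` over `ℚ` (read off the tabulated level). [cite: HogervorstRychkov2013, §3 eq. (3.9)] -/
def hrCoeffHiQ (Δ₁ Δ₂ : ℚ) (ℓ n j : ℕ) : ℚ := vget (hrRowHiQ Δ₁ Δ₂ ℓ n) j

/-- Off the descendant range the real lower table vanishes. [folklore] -/
theorem hrCoeffLo_off (Δ₁ Δ₂ : ℝ) {ℓ n j : ℕ} (h : ¬ InDescendantRange ℓ n j) :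
    hrCoeffLo Δ₁ Δ₂ ℓ n j = 0 := by
  cases n with
  | zero =>
    rw [hrCoeffLo_zero, if_neg]
    rintro rfl
    exact h (by unfold InDescendantRange; omega)
  | succ n => rw [hrCoeffLo_succ, if_neg h]

/-- Off the descendant range the real upper table vanishes. [folklore] -/
theorem hrCoeffHi_off (Δ₁ Δ₂ : ℝ) {ℓ n j : ℕ} (h : ¬ InDescendantRange ℓ n j) :
    hrCoeffHi Δ₁ Δ₂ ℓ n j = 0 := by
  cases n with
  | zero =>
    rw [hrCoeffHi_zero, if_neg]
    rintro rfl
    exact h (by unfold InDescendantRange; omega)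
  | succ n => rw [hrCoeffHi_succ, if_neg h]

/-- [cite: HogervorstRychkov2013, §3 eq. (3.9)] -/
theorem cast_hrCoeffLoQ (Δ₁ Δ₂ : ℚ) (ℓ : ℕ) :
    ∀ n j : ℕ, ((hrCoeffLoQ Δ₁ Δ₂ ℓ n j : ℚ) : ℝ) = hrCoeffLo (Δ₁ : ℝ) (Δ₂ : ℝ) ℓ n j
  | 0, j => by
    unfold hrCoeffLoQ hrRowLoQ
    rw [hrCoeffLo_zero]
    by_cases hj : j < ℓ + 1
    · rw [vget_vtab _ hj]
      split_ifs <;> simp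
    · rw [vget_of_length_le (by simp [vtab]; omega), if_neg (by omega)]
      simp
  | n + 1, j => by
    unfold hrCoeffLoQ
    simp only [hrRowLoQ]
    rw [hrCoeffLo_succ]
    by_cases hj : j < ℓ + n + 2
    · rw [vget_vtab _ hj]
      unfold hrStepLoQ
      have h1 := cast_hrCoeffLoQ Δ₁ Δ₂ ℓ n (j - 1)
      have h2 := cast_hrCoeffLoQ Δ₁ Δ₂ ℓ n (j + 1)
      unfold hrCoeffLoQ at h1 h2
      by_cases hr : InDescendantRange ℓ (n + 1) j
      · rw [if_pos hr, if_pos hr]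
        split_ifs with hj0
        · push_cast
          rw [h2, cast_hrGammaMinusLoQ, cast_casimirPivotQ]
          push_cast
          ring
        · push_cast
          rw [h1, h2, cast_hrGammaPlusLoQ, cast_hrGammaMinusLoQ, cast_casimirPivotQ]
          push_cast
          ring
      · rw [if_neg hr, if_neg hr]
        simp
    · rw [vget_of_length_le (by simp [vtab]; omega), if_neg (by unfold InDescendantRange; omega)]
      simp

/-- [cite: HogervorstRychkov2013, §3 eq. (3.9)] -/
theorem cast_hrCoeffHiQ (Δ₁ Δ₂ : ℚ) (ℓ : ℕ) :
    ∀ n j : ℕ, ((hrCoeffHiQ Δ₁ Δ₂ ℓ n j : ℚ) : ℝ) = hrCoeffHi (Δ₁ : ℝ) (Δ₂ : ℝ) ℓ n j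
  | 0, j => by
    unfold hrCoeffHiQ hrRowHiQ
    rw [hrCoeffHi_zero]
    by_cases hj : j < ℓ + 1
    · rw [vget_vtab _ hj]
      split_ifs <;> simp
    · rw [vget_of_length_le (by simp [vtab]; omega), if_neg (by omega)]
      simp
  | n + 1, j => by
    unfold hrCoeffHiQ
    simp only [hrRowHiQ]
    rw [hrCoeffHi_succ]
    by_cases hj : j < ℓ + n + 2
    · rw [vget_vtab _ hj]
      unfold hrStepHiQ
      have h1 := cast_hrCoeffHiQ Δ₁ Δ₂ ℓ n (j - 1)
      have h2 := cast_hrCoeffHiQ Δ₁ Δ₂ ℓ n (j + 1)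
      unfold hrCoeffHiQ at h1 h2
      by_cases hr : InDescendantRange ℓ (n + 1) j
      · rw [if_pos hr, if_pos hr]
        split_ifs with hj0
        · push_cast
          rw [h2, cast_hrGammaMinusHiQ, cast_casimirPivotQ]
          push_cast
          ring
        · push_cast
          rw [h1, h2, cast_hrGammaPlusHiQ, cast_hrGammaMinusHiQ, cast_casimirPivotQ]
          push_cast
          ring
      · rw [if_neg hr, if_neg hr]
        simp
    · rw [vget_of_length_le (by simp [vtab]; omega), if_neg (by unfold InDescendantRange; omega)]
      simp

/-- all levels `0..n` of the lower interval table, newest first (one step per level). [folklore] -/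
def hrRowListLo (Δ₁ Δ₂ : ℚ) (ℓ : ℕ) : ℕ → List (List ℚ)
  | 0 => [hrRowLoQ Δ₁ Δ₂ ℓ 0]
  | n + 1 => (vtab (ℓ + n + 2) (hrStepLoQ Δ₁ Δ₂ ℓ n ((hrRowListLo Δ₁ Δ₂ ℓ n).headD []))) ::
      hrRowListLo Δ₁ Δ₂ ℓ n

/-- all levels `0..n` of the upper interval table, newest first. [folklore] -/
def hrRowListHi (Δ₁ Δ₂ : ℚ) (ℓ : ℕ) : ℕ → List (List ℚ)
  | 0 => [hrRowHiQ Δ₁ Δ₂ ℓ 0]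
  | n + 1 => (vtab (ℓ + n + 2) (hrStepHiQ Δ₁ Δ₂ ℓ n ((hrRowListHi Δ₁ Δ₂ ℓ n).headD []))) ::
      hrRowListHi Δ₁ Δ₂ ℓ n

/-- head of the lower row list. [folklore] -/
theorem hrRowListLo_headD (Δ₁ Δ₂ : ℚ) (ℓ : ℕ) :
    ∀ n, (hrRowListLo Δ₁ Δ₂ ℓ n).headD [] = hrRowLoQ Δ₁ Δ₂ ℓ n
  | 0 => rfl
  | n + 1 => by simp only [hrRowListLo, List.headD_cons, hrRowListLo_headD Δ₁ Δ₂ ℓ n]; rfl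

/-- head of the upper row list. [folklore] -/
theorem hrRowListHi_headD (Δ₁ Δ₂ : ℚ) (ℓ : ℕ) :
    ∀ n, (hrRowListHi Δ₁ Δ₂ ℓ n).headD [] = hrRowHiQ Δ₁ Δ₂ ℓ n
  | 0 => rfl
  | n + 1 => by simp only [hrRowListHi, List.headD_cons, hrRowListHi_headD Δ₁ Δ₂ ℓ n]; rfl

/-- entries of the lower row list. [folklore] -/
theorem hrRowListLo_getD (Δ₁ Δ₂ : ℚ) (ℓ : ℕ) :
    ∀ n i, i ≤ n → (hrRowListLo Δ₁ Δ₂ ℓ n).getD (n - i) [] = hrRowLoQ Δ₁ Δ₂ ℓ i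
  | 0, i, hi => by
    obtain rfl : i = 0 := by omega
    rfl
  | n + 1, i, hi => by
    rcases Nat.lt_or_ge i (n + 1) with h | h
    · rw [show n + 1 - i = (n - i) + 1 by omega, hrRowListLo, List.getD_cons_succ]
      exact hrRowListLo_getD Δ₁ Δ₂ ℓ n i (by omega)
    · obtain rfl : i = n + 1 := by omega
      rw [Nat.sub_self, hrRowListLo, List.getD_cons_zero, hrRowListLo_headD]
      rfl

/-- entries of the upper row list. [folklore] -/
theorem hrRowListHi_getD (Δ₁ Δ₂ : ℚ) (ℓ : ℕ) :
    ∀ n i, i ≤ n → (hrRowListHi Δ₁ Δ₂ ℓ n).getD (n - i) [] = hrRowHiQ Δ₁ Δ₂ ℓ i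
  | 0, i, hi => by
    obtain rfl : i = 0 := by omega
    rfl
  | n + 1, i, hi => by
    rcases Nat.lt_or_ge i (n + 1) with h | h
    · rw [show n + 1 - i = (n - i) + 1 by omega, hrRowListHi, List.getD_cons_succ]
      exact hrRowListHi_getD Δ₁ Δ₂ ℓ n i (by omega)
    · obtain rfl : i = n + 1 := by omega
      rw [Nat.sub_self, hrRowListHi, List.getD_cons_zero, hrRowListHi_headD]
      rfl


/-! ### Interval CORNER head cells: `0 ≤ headNumberI … n_F false` -/

namespace PCert

variable (c : PCert)

/-- **Interval head-cell lower sum** (times `S`): the landed summand `qLo` fed with the interval rows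
`(Lo_{n,·}, Hi_{n,·})` in place of `(A(a)ρ, A(b)ρ')` (`ρ = ρ' = 1`). [folklore] -/
def cellLoI (nc : List NC4) (LT LTt : List (List ℚ)) (ℓ : ℕ) (XA XB YA YB : List MI)
    (Los His : List (List ℚ)) (nF : ℕ) : ℤ :=
  let IU := c.iuTab (c.duList nc XA XB) ℓ nF
  let IV := c.ivTab (c.dvList nc YA YB) ℓ nF
  rsum (nF + 1) fun n =>
    let Lo := Los.getD (nF - n) []
    let Hi := His.getD (nF - n) []
    rsum (ℓ + nF + 1) fun j => qLo ℓ LT LTt IU IV Lo Hi 1 1 n j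

/-- side conditions of an interval head cell: `ℓ` even, both interval tables `≥ 0` on the head set
(read off the row lists, newest first). [folklore] -/
def cellSideOKI (ℓ : ℕ) (Los His : List (List ℚ)) (nF : ℕ) : Bool :=
  decide (Even ℓ) &&
  rall (nF + 1) fun n => rall (ℓ + nF + 1) fun j =>
    decide (0 ≤ vget (Los.getD (nF - n) []) j) && decide (0 ≤ vget (His.getD (nF - n) []) j)

/-- **Interval corner head-cell check** on `[2e_a, 2e_b]`. [folklore] -/
def cellOKI (nc : List NC4) (LT LTt : List (List ℚ)) (ℓ : ℕ) (ea eb : ℚ) (XA XB YA YB : List MI)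
    (nF : ℕ) : Bool :=
  let Los := hrRowListLo (2 * ea) (2 * eb) ℓ nF
  let His := hrRowListHi (2 * ea) (2 * eb) ℓ nF
  cellSideOKI ℓ Los His nF && decide (0 ≤ c.cellLoI nc LT LTt ℓ XA XB YA YB Los His nF)

variable {c}

/-- **Soundness of one corner summand with arbitrary nonnegative coefficient rows** (`ρ = ρ' = 1`).
[folklore] -/
theorem qLo_le_coef (hc : c.checkNodes = true) {ℓ : ℕ} (hℓ : Even ℓ) (ea eb : ℚ) (XA XB YA YB : List MI)
    (hXA : ∀ k < c.N, MI.mem c.S (((c.u k : ℚ) : ℝ) ^ ((ea : ℚ) : ℝ)) (miAt XA k))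
    (hXB : ∀ k < c.N, MI.mem c.S (((c.u k : ℚ) : ℝ) ^ ((eb : ℚ) : ℝ)) (miAt XB k))
    (hYA : ∀ k < c.N, MI.mem c.S (((c.v k : ℚ) : ℝ) ^ ((ea : ℚ) : ℝ)) (miAt YA k))
    (hYB : ∀ k < c.N, MI.mem c.S (((c.v k : ℚ) : ℝ) ^ ((eb : ℚ) : ℝ)) (miAt YB k))
    (nF : ℕ) {J : ℕ} (hJ : ℓ + nF ≤ J) {n j : ℕ} (hn : n ≤ nF) (hj : j ≤ ℓ + nF)
    (RA RB : List ℚ) (hA : 0 ≤ vget RA j) (hB : 0 ≤ vget RB j) :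
    ((qLo ℓ (c.legTabs J) (c.legTabsT J) (c.iuTab (c.duList c.ncTab XA XB) ℓ nF)
        (c.ivTab (c.dvList c.ncTab YA YB) ℓ nF) RA RB 1 1 n j : ℤ) : ℝ) ≤
      c.S * (if InDescendantRange ℓ n j then
        min (((vget RA j : ℚ) : ℝ) *
              termCornerBound c.wR c.zR c.zbR j ((((2 * ea : ℚ)) : ℝ) + (n : ℕ)) ((((2 * eb : ℚ)) : ℝ) + (n : ℕ))
                ((c.slo : ℚ) : ℝ) ((c.shi : ℚ) : ℝ))
            (((vget RB j : ℚ) : ℝ) *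
              termCornerBound c.wR c.zR c.zbR j ((((2 * ea : ℚ)) : ℝ) + (n : ℕ)) ((((2 * eb : ℚ)) : ℝ) + (n : ℕ))
                ((c.slo : ℚ) : ℝ) ((c.shi : ℚ) : ℝ))
        else 0) := by
  have hS := S_pos hc
  have hSR : (0 : ℝ) < c.S := by exact_mod_cast hS
  unfold qLo
  by_cases hR : InDescendantRange ℓ n j
  swap
  · rw [if_neg hR, if_neg hR]
    simp
  rw [if_pos hR, if_pos hR]
  obtain ⟨hR1, hR2, hR3⟩ := hR
  set m' := (n + ℓ - j) / 2 with hm'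
  have h2 : 2 * m' = n + ℓ - j := by omega
  have hm'F : m' < nF + 1 := by omega
  set T := termCornerBound c.wR c.zR c.zbR j ((((2 * ea : ℚ)) : ℝ) + (n : ℕ)) ((((2 * eb : ℚ)) : ℝ) + (n : ℕ))
      ((c.slo : ℚ) : ℝ) ((c.shi : ℚ) : ℝ) with hT
  have hTeq := tcb_shift_eq hc hℓ h2 (by omega) ea eb
  set Tlo := dot2 ((c.legTabs J).map fun l => vget l j) ((c.iuTab (c.duList c.ncTab XA XB) ℓ nF).getD m' [])
      ((c.legTabsT J).map fun l => vget l j) ((c.ivTab (c.dvList c.ncTab YA YB) ℓ nF).getD m' []) with hTlo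
  have hIU : (c.iuTab (c.duList c.ncTab XA XB) ℓ nF).getD m' [] =
      vtab c.N fun k => floorMul (c.u k ^ ((m' : ℤ) - (ℓ / 2 : ℕ))) ((c.duList c.ncTab XA XB).getD k 0) := by
    rw [iuTab, getD_vtab _ _ _ hm'F]
  have hIV : (c.ivTab (c.dvList c.ncTab YA YB) ℓ nF).getD m' [] =
      vtab c.N fun k => floorMul (c.v k ^ ((m' : ℤ) - (ℓ / 2 : ℕ))) ((c.dvList c.ncTab YA YB).getD k 0) := by
    rw [ivTab, getD_vtab _ _ _ hm'F]
  have hTS : (Tlo : ℝ) ≤ T * c.S := by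
    have hlen : ((c.legTabs J).map fun l => vget l j).length = c.N := by simp [legTabs, vtab]
    rw [hTlo, hIU, hIV, dot2_eq _ _ _ _ (by simp [vtab, legTabs]) (by simp [vtab, legTabs, legTabsT])
      (by simp [vtab, legTabs]), hlen, hT, hTeq, sum_mul, Int.cast_sum]
    refine sum_le_sum fun k hk => ?_
    rw [mem_range] at hk
    have hnd := checkNode_of_checkNodes hc hk
    have hjJ : j ≤ J := by omega
    rw [legTabs, legTabsT, vget_map_vtab _ _ _ hk, vget_map_vtab _ _ _ hk, vget_legTab hjJ, vget_legTab hjJ,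
      getD_vtab _ _ _ hk, getD_vtab _ _ _ hk]
    have hncd : c.ncTab.getD k ⟨⟨0,0⟩,⟨0,0⟩,⟨0,0⟩,⟨0,0⟩⟩ = c.nc4 k := by rw [ncTab, getD_vtab _ _ _ hk]
    obtain ⟨m1, m2, m3, m4⟩ := mem_nc4 hc hk
    have hdU := mem_DU hS m1 m2 (hXA k hk) (hXB k hk)
    have hdV := mem_DV hS m3 m4 (hYA k hk) (hYB k hk)
    have eU : (c.duList c.ncTab XA XB).getD k 0 = (DU c.S (c.nc4 k) (miAt XA k) (miAt XB k)).lo := by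
      rw [duList, getD_vtab _ _ _ hk, hncd]
    have eV : (c.dvList c.ncTab YA YB).getD k 0 = (DV c.S (c.nc4 k) (miAt YA k) (miAt YB k)).lo := by
      rw [dvList, getD_vtab _ _ _ hk, hncd]
    rw [eU, eV]
    have i1 := floorMul_le (zpow_nonneg (u_pos hnd).le ((m' : ℤ) - (ℓ / 2 : ℕ))) hdU.1
    have i2 := floorMul_le (zpow_nonneg (v_pos hnd).le ((m' : ℤ) - (ℓ / 2 : ℕ))) hdV.1
    have j1 := floorMul_le (zLegendreQ_nonneg j (x := c.z k) (y := c.zb k) (z_pos hnd).le (zb_pos hnd).le) i1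
    have j2 := floorMul_le (zLegendreQ_nonneg j (x := 1 - c.z k) (y := 1 - c.zb k)
      (by linarith [z_lt_one hnd]) (by linarith [zb_lt_one hnd])) i2
    push_cast at j1 j2 ⊢
    linarith [j1, j2]
  have cA : 0 ≤ vget RA j * 1 := by simpa using hA
  have cB : 0 ≤ vget RB j * 1 := by simpa using hB
  have k1 := floorMul_le cA hTS
  have k2 := floorMul_le cB hTS
  have e1 : (((vget RA j * 1 : ℚ)) : ℝ) = ((vget RA j : ℚ) : ℝ) := by push_cast; ring
  have e2 : (((vget RB j * 1 : ℚ)) : ℝ) = ((vget RB j : ℚ) : ℝ) := by push_cast; ring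
  rw [e1] at k1
  rw [e2] at k2
  rw [mul_min_of_nonneg _ _ hSR.le, Int.cast_min]
  refine min_le_min ?_ ?_ <;> nlinarith [k1, k2]

/-- **Soundness of the interval corner head-cell check**:
`0 ≤ headNumberI w z z̄ ℓ (2e_a) (2e_b) slo shi n_F false`. [folklore] -/
theorem cell_soundI (hc : c.checkNodes = true) {ℓ : ℕ} (ea eb : ℚ) (XA XB YA YB : List MI)
    (hXA : ∀ k < c.N, MI.mem c.S (((c.u k : ℚ) : ℝ) ^ ((ea : ℚ) : ℝ)) (miAt XA k))
    (hXB : ∀ k < c.N, MI.mem c.S (((c.u k : ℚ) : ℝ) ^ ((eb : ℚ) : ℝ)) (miAt XB k))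
    (hYA : ∀ k < c.N, MI.mem c.S (((c.v k : ℚ) : ℝ) ^ ((ea : ℚ) : ℝ)) (miAt YA k))
    (hYB : ∀ k < c.N, MI.mem c.S (((c.v k : ℚ) : ℝ) ^ ((eb : ℚ) : ℝ)) (miAt YB k))
    (nF : ℕ) {J : ℕ} (hJ : ℓ + nF ≤ J)
    (h : c.cellOKI c.ncTab (c.legTabs J) (c.legTabsT J) ℓ ea eb XA XB YA YB nF = true) :
    0 ≤ headNumberI c.wR c.zR c.zbR ℓ (((2 * ea : ℚ)) : ℝ) (((2 * eb : ℚ)) : ℝ) ((c.slo : ℚ) : ℝ)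
      ((c.shi : ℚ) : ℝ) nF false := by
  have hS := S_pos hc
  have hSR : (0 : ℝ) < c.S := by exact_mod_cast hS
  simp only [cellOKI, cellSideOKI, Bool.and_eq_true, decide_eq_true_eq] at h
  obtain ⟨⟨hℓ, hall⟩, hlo⟩ := h
  simp only [headNumberI, Bool.false_eq_true, ↓reduceIte, headCellBoundI, headCellSumI, headSet,
    Finset.sum_product]
  have hloR : (0 : ℝ) ≤ (c.cellLoI c.ncTab (c.legTabs J) (c.legTabsT J) ℓ XA XB YA YB
      (hrRowListLo (2 * ea) (2 * eb) ℓ nF) (hrRowListHi (2 * ea) (2 * eb) ℓ nF) nF : ℝ) := by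
    exact_mod_cast hlo
  simp only [cellLoI, rsum_eq_sum, Int.cast_sum] at hloR
  -- the value of the summand `(n, j)` of `headCellSumI`, as an `if`
  have hval : ∀ n j : ℕ,
      min (hrCoeffLo (((2 * ea : ℚ)) : ℝ) (((2 * eb : ℚ)) : ℝ) ℓ n j *
            termCornerBound c.wR c.zR c.zbR j ((((2 * ea : ℚ)) : ℝ) + (n : ℕ)) ((((2 * eb : ℚ)) : ℝ) + (n : ℕ))
              ((c.slo : ℚ) : ℝ) ((c.shi : ℚ) : ℝ))
          (hrCoeffHi (((2 * ea : ℚ)) : ℝ) (((2 * eb : ℚ)) : ℝ) ℓ n j *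
            termCornerBound c.wR c.zR c.zbR j ((((2 * ea : ℚ)) : ℝ) + (n : ℕ)) ((((2 * eb : ℚ)) : ℝ) + (n : ℕ))
              ((c.slo : ℚ) : ℝ) ((c.shi : ℚ) : ℝ)) =
      (if InDescendantRange ℓ n j then
        min (((vget (hrRowLoQ (2 * ea) (2 * eb) ℓ n) j : ℚ) : ℝ) *
              termCornerBound c.wR c.zR c.zbR j ((((2 * ea : ℚ)) : ℝ) + (n : ℕ)) ((((2 * eb : ℚ)) : ℝ) + (n : ℕ))
                ((c.slo : ℚ) : ℝ) ((c.shi : ℚ) : ℝ))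
            (((vget (hrRowHiQ (2 * ea) (2 * eb) ℓ n) j : ℚ) : ℝ) *
              termCornerBound c.wR c.zR c.zbR j ((((2 * ea : ℚ)) : ℝ) + (n : ℕ)) ((((2 * eb : ℚ)) : ℝ) + (n : ℕ))
                ((c.slo : ℚ) : ℝ) ((c.shi : ℚ) : ℝ))
        else 0) := by
    intro n j
    by_cases hR : InDescendantRange ℓ n j
    · rw [if_pos hR, show vget (hrRowLoQ (2 * ea) (2 * eb) ℓ n) j = hrCoeffLoQ (2 * ea) (2 * eb) ℓ n j from rfl,
        show vget (hrRowHiQ (2 * ea) (2 * eb) ℓ n) j = hrCoeffHiQ (2 * ea) (2 * eb) ℓ n j from rfl,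
        cast_hrCoeffLoQ, cast_hrCoeffHiQ]
    · rw [if_neg hR, hrCoeffLo_off _ _ hR, hrCoeffHi_off _ _ hR]
      simp
  have key : ∀ n ∈ range (nF + 1), ∀ j ∈ range (ℓ + nF + 1),
      ((qLo ℓ (c.legTabs J) (c.legTabsT J) (c.iuTab (c.duList c.ncTab XA XB) ℓ nF)
        (c.ivTab (c.dvList c.ncTab YA YB) ℓ nF) ((hrRowListLo (2 * ea) (2 * eb) ℓ nF).getD (nF - n) [])
        ((hrRowListHi (2 * ea) (2 * eb) ℓ nF).getD (nF - n) []) 1 1 n j : ℤ) : ℝ) ≤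
      c.S * min
        (hrCoeffLo (((2 * ea : ℚ)) : ℝ) (((2 * eb : ℚ)) : ℝ) ℓ n j *
            termCornerBound c.wR c.zR c.zbR j ((((2 * ea : ℚ)) : ℝ) + (n : ℕ)) ((((2 * eb : ℚ)) : ℝ) + (n : ℕ))
              ((c.slo : ℚ) : ℝ) ((c.shi : ℚ) : ℝ))
        (hrCoeffHi (((2 * ea : ℚ)) : ℝ) (((2 * eb : ℚ)) : ℝ) ℓ n j *
            termCornerBound c.wR c.zR c.zbR j ((((2 * ea : ℚ)) : ℝ) + (n : ℕ)) ((((2 * eb : ℚ)) : ℝ) + (n : ℕ))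
              ((c.slo : ℚ) : ℝ) ((c.shi : ℚ) : ℝ)) := by
    intro n hn j hj
    rw [mem_range] at hn hj
    have hrow := of_rall hall hn
    have hab := of_rall hrow hj
    simp only [Bool.and_eq_true, decide_eq_true_eq] at hab
    rw [hrRowListLo_getD _ _ _ _ _ (by omega), hrRowListHi_getD _ _ _ _ _ (by omega)] at hab ⊢
    rw [hval]
    exact qLo_le_coef hc hℓ ea eb XA XB YA YB hXA hXB hYA hYB nF hJ (by omega) (by omega) _ _ hab.1 hab.2
  have := sum_le_sum fun n hn => sum_le_sum fun j hj => key n hn j hj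
  simp only [← mul_sum] at this
  nlinarith [this, hloR, hSR]

/-! ### Interval CHORD head cells: `0 ≤ headNumberI … n_F true` -/

variable (c)

/-- **Interval chord head-cell lower sum** (times `S`): the landed summand `qLoC` fed with the
interval rows. [folklore] -/
def cellLoCI (ncc : List NCC) (LT LTt : List (List ℚ)) (ℓ : ℕ) (t : ℕ) (XA YA : List MI)
    (Los His : List (List ℚ)) (nF : ℕ) : ℤ :=
  let IU00 := c.iuTab (c.duListC false false ncc t XA) ℓ nF
  let IU10 := c.iuTab (c.duListC true false ncc t XA) ℓ nF
  let IU01 := c.iuTab (c.duListC false true ncc t XA) ℓ nF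
  let IU11 := c.iuTab (c.duListC true true ncc t XA) ℓ nF
  let IV00 := c.ivTab (c.dvListC false false ncc t YA) ℓ nF
  let IV10 := c.ivTab (c.dvListC true false ncc t YA) ℓ nF
  let IV01 := c.ivTab (c.dvListC false true ncc t YA) ℓ nF
  let IV11 := c.ivTab (c.dvListC true true ncc t YA) ℓ nF
  rsum (nF + 1) fun n =>
    let Lo := Los.getD (nF - n) []
    let Hi := His.getD (nF - n) []
    rsum (ℓ + nF + 1) fun j => qLoC ℓ LT LTt IU00 IU10 IU01 IU11 IV00 IV10 IV01 IV11 Lo Hi 1 1 n j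

/-- **Interval chord head-cell check** on `[2e_a, 2(e_a + ρ_t)]`. [folklore] -/
def cellOKCI (ncc : List NCC) (LT LTt : List (List ℚ)) (ℓ : ℕ) (ea : ℚ) (t : ℕ) (XA YA : List MI)
    (nF : ℕ) : Bool :=
  let Los := hrRowListLo (2 * ea) (2 * (ea + atomExp c.rho t)) ℓ nF
  let His := hrRowListHi (2 * ea) (2 * (ea + atomExp c.rho t)) ℓ nF
  cellSideOKI ℓ Los His nF && c.stepOKC t && decide (0 ≤ c.cellLoCI ncc LT LTt ℓ t XA YA Los His nF)

variable {c}

/-- **Soundness of one chord summand with arbitrary nonnegative coefficient rows** (`ρ = ρ' = 1`).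
[folklore] -/
theorem qLoC_le_coef (hc : c.checkNodes = true) (hn : c.nccOK = true) {ℓ : ℕ} (hℓ : Even ℓ) (ea : ℚ)
    (t : ℕ) (hst : c.stepOKC t = true) (XA YA : List MI)
    (hXA : ∀ k < c.N, MI.mem c.S (((c.u k : ℚ) : ℝ) ^ ((ea : ℚ) : ℝ)) (miAt XA k))
    (hYA : ∀ k < c.N, MI.mem c.S (((c.v k : ℚ) : ℝ) ^ ((ea : ℚ) : ℝ)) (miAt YA k))
    (nF : ℕ) {J : ℕ} (hJ : ℓ + nF ≤ J) {n j : ℕ} (hnn : n ≤ nF) (hj : j ≤ ℓ + nF)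
    (RA RB : List ℚ) (hA : 0 ≤ vget RA j) (hB : 0 ≤ vget RB j) :
    ((qLoC ℓ (c.legTabs J) (c.legTabsT J)
        (c.iuTab (c.duListC false false c.nccTab t XA) ℓ nF) (c.iuTab (c.duListC true false c.nccTab t XA) ℓ nF)
        (c.iuTab (c.duListC false true c.nccTab t XA) ℓ nF) (c.iuTab (c.duListC true true c.nccTab t XA) ℓ nF)
        (c.ivTab (c.dvListC false false c.nccTab t YA) ℓ nF) (c.ivTab (c.dvListC true false c.nccTab t YA) ℓ nF)
        (c.ivTab (c.dvListC false true c.nccTab t YA) ℓ nF) (c.ivTab (c.dvListC true true c.nccTab t YA) ℓ nF)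
        RA RB 1 1 n j : ℤ) : ℝ) ≤
      c.S * (if InDescendantRange ℓ n j then
        min (((vget RA j : ℚ) : ℝ) *
              termChordMin c.wR c.zR c.zbR j ((c.slo : ℚ) : ℝ) ((c.shi : ℚ) : ℝ)
                ((((2 * ea : ℚ)) : ℝ) + (n : ℕ)) ((((2 * (ea + atomExp c.rho t) : ℚ)) : ℝ) + (n : ℕ)))
            (((vget RB j : ℚ) : ℝ) *
              termChordMin c.wR c.zR c.zbR j ((c.slo : ℚ) : ℝ) ((c.shi : ℚ) : ℝ)
                ((((2 * ea : ℚ)) : ℝ) + (n : ℕ)) ((((2 * (ea + atomExp c.rho t) : ℚ)) : ℝ) + (n : ℕ)))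
        else 0) := by
  have hS := S_pos hc
  have hSR : (0 : ℝ) < c.S := by exact_mod_cast hS
  unfold qLoC
  by_cases hR : InDescendantRange ℓ n j
  swap
  · rw [if_neg hR, if_neg hR]
    simp
  rw [if_pos hR, if_pos hR]
  obtain ⟨hR1, hR2, hR3⟩ := hR
  set m' := (n + ℓ - j) / 2 with hm'
  have h2 : 2 * m' = n + ℓ - j := by omega
  have hm'F : m' < nF + 1 := by omega
  have hjJ : j ≤ J := by omega
  set Φ := termChordMin c.wR c.zR c.zbR j ((c.slo : ℚ) : ℝ) ((c.shi : ℚ) : ℝ)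
      ((((2 * ea : ℚ)) : ℝ) + (n : ℕ)) ((((2 * (ea + atomExp c.rho t) : ℚ)) : ℝ) + (n : ℕ)) with hΦ
  have v00 := dot2C_le hc hn false false hℓ h2 (by omega) ea t hst XA YA hXA hYA nF hm'F hjJ
  have v10 := dot2C_le hc hn true false hℓ h2 (by omega) ea t hst XA YA hXA hYA nF hm'F hjJ
  have v01 := dot2C_le hc hn false true hℓ h2 (by omega) ea t hst XA YA hXA hYA nF hm'F hjJ
  have v11 := dot2C_le hc hn true true hℓ h2 (by omega) ea t hst XA YA hXA hYA nF hm'F hjJ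
  set T := min (min
      (dot2 ((c.legTabs J).map fun l => vget l j) ((c.iuTab (c.duListC false false c.nccTab t XA) ℓ nF).getD m' [])
        ((c.legTabsT J).map fun l => vget l j) ((c.ivTab (c.dvListC false false c.nccTab t YA) ℓ nF).getD m' []))
      (dot2 ((c.legTabs J).map fun l => vget l j) ((c.iuTab (c.duListC true false c.nccTab t XA) ℓ nF).getD m' [])
        ((c.legTabsT J).map fun l => vget l j) ((c.ivTab (c.dvListC true false c.nccTab t YA) ℓ nF).getD m' [])))
    (min
      (dot2 ((c.legTabs J).map fun l => vget l j) ((c.iuTab (c.duListC false true c.nccTab t XA) ℓ nF).getD m' [])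
        ((c.legTabsT J).map fun l => vget l j) ((c.ivTab (c.dvListC false true c.nccTab t YA) ℓ nF).getD m' []))
      (dot2 ((c.legTabs J).map fun l => vget l j) ((c.iuTab (c.duListC true true c.nccTab t XA) ℓ nF).getD m' [])
        ((c.legTabsT J).map fun l => vget l j) ((c.ivTab (c.dvListC true true c.nccTab t YA) ℓ nF).getD m' [])))
    with hT
  have hTS : (T : ℝ) ≤ Φ * c.S := by
    rw [hΦ, termChordMin_eq_bR, min_mul_of_nonneg _ _ hSR.le, min_mul_of_nonneg _ _ hSR.le,
      min_mul_of_nonneg _ _ hSR.le, hT]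
    push_cast at v00 v10 v01 v11 ⊢
    exact min_le_min (min_le_min v00 v10) (min_le_min v01 v11)
  have cA : 0 ≤ vget RA j * 1 := by simpa using hA
  have cB : 0 ≤ vget RB j * 1 := by simpa using hB
  have k1 := floorMul_le cA hTS
  have k2 := floorMul_le cB hTS
  have e1 : (((vget RA j * 1 : ℚ)) : ℝ) = ((vget RA j : ℚ) : ℝ) := by push_cast; ring
  have e2 : (((vget RB j * 1 : ℚ)) : ℝ) = ((vget RB j : ℚ) : ℝ) := by push_cast; ring
  rw [e1] at k1
  rw [e2] at k2
  rw [mul_min_of_nonneg _ _ hSR.le, Int.cast_min]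
  refine min_le_min ?_ ?_ <;> nlinarith [k1, k2]

/-- **Soundness of the interval chord head-cell check**: the number `headNumberI … true ≥ 0` AND the
half conditions of the cell width. [folklore] -/
theorem cell_soundCI (hc : c.checkNodes = true) (hn : c.nccOK = true) {ℓ : ℕ} (ea : ℚ) (t : ℕ)
    (XA YA : List MI)
    (hXA : ∀ k < c.N, MI.mem c.S (((c.u k : ℚ) : ℝ) ^ ((ea : ℚ) : ℝ)) (miAt XA k))
    (hYA : ∀ k < c.N, MI.mem c.S (((c.v k : ℚ) : ℝ) ^ ((ea : ℚ) : ℝ)) (miAt YA k))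
    (nF : ℕ) {J : ℕ} (hJ : ℓ + nF ≤ J)
    (h : c.cellOKCI c.nccTab (c.legTabs J) (c.legTabsT J) ℓ ea t XA YA nF = true) :
    0 ≤ headNumberI c.wR c.zR c.zbR ℓ (((2 * ea : ℚ)) : ℝ) (((2 * (ea + atomExp c.rho t) : ℚ)) : ℝ)
      ((c.slo : ℚ) : ℝ) ((c.shi : ℚ) : ℝ) nF true ∧
    ∀ i : Fin c.N, 1 / 2 ≤ (c.zR i * c.zbR i) ^
        (((((2 * (ea + atomExp c.rho t) : ℚ)) : ℝ) - (((2 * ea : ℚ)) : ℝ)) / 2) ∧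
      1 / 2 ≤ ((1 - c.zR i) * (1 - c.zbR i)) ^
        (((((2 * (ea + atomExp c.rho t) : ℚ)) : ℝ) - (((2 * ea : ℚ)) : ℝ)) / 2) := by
  have hS := S_pos hc
  have hSR : (0 : ℝ) < c.S := by exact_mod_cast hS
  simp only [cellOKCI, cellSideOKI, Bool.and_eq_true, decide_eq_true_eq] at h
  obtain ⟨⟨⟨hℓ, hall⟩, hst⟩, hlo⟩ := h
  refine ⟨?_, fun i => ?_⟩
  · simp only [headNumberI, ↓reduceIte, headChordBoundI, headCellSumI, headSet, Finset.sum_product]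
    have hloR : (0 : ℝ) ≤ (c.cellLoCI c.nccTab (c.legTabs J) (c.legTabsT J) ℓ t XA YA
        (hrRowListLo (2 * ea) (2 * (ea + atomExp c.rho t)) ℓ nF)
        (hrRowListHi (2 * ea) (2 * (ea + atomExp c.rho t)) ℓ nF) nF : ℝ) := by
      exact_mod_cast hlo
    simp only [cellLoCI, rsum_eq_sum, Int.cast_sum] at hloR
    have hval : ∀ n j : ℕ,
        min (hrCoeffLo (((2 * ea : ℚ)) : ℝ) (((2 * (ea + atomExp c.rho t) : ℚ)) : ℝ) ℓ n j *
              termChordMin c.wR c.zR c.zbR j ((c.slo : ℚ) : ℝ) ((c.shi : ℚ) : ℝ)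
                ((((2 * ea : ℚ)) : ℝ) + (n : ℕ)) ((((2 * (ea + atomExp c.rho t) : ℚ)) : ℝ) + (n : ℕ)))
            (hrCoeffHi (((2 * ea : ℚ)) : ℝ) (((2 * (ea + atomExp c.rho t) : ℚ)) : ℝ) ℓ n j *
              termChordMin c.wR c.zR c.zbR j ((c.slo : ℚ) : ℝ) ((c.shi : ℚ) : ℝ)
                ((((2 * ea : ℚ)) : ℝ) + (n : ℕ)) ((((2 * (ea + atomExp c.rho t) : ℚ)) : ℝ) + (n : ℕ))) =
        (if InDescendantRange ℓ n j then
          min (((vget (hrRowLoQ (2 * ea) (2 * (ea + atomExp c.rho t)) ℓ n) j : ℚ) : ℝ) *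
                termChordMin c.wR c.zR c.zbR j ((c.slo : ℚ) : ℝ) ((c.shi : ℚ) : ℝ)
                  ((((2 * ea : ℚ)) : ℝ) + (n : ℕ)) ((((2 * (ea + atomExp c.rho t) : ℚ)) : ℝ) + (n : ℕ)))
              (((vget (hrRowHiQ (2 * ea) (2 * (ea + atomExp c.rho t)) ℓ n) j : ℚ) : ℝ) *
                termChordMin c.wR c.zR c.zbR j ((c.slo : ℚ) : ℝ) ((c.shi : ℚ) : ℝ)
                  ((((2 * ea : ℚ)) : ℝ) + (n : ℕ)) ((((2 * (ea + atomExp c.rho t) : ℚ)) : ℝ) + (n : ℕ)))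
          else 0) := by
      intro n j
      by_cases hR : InDescendantRange ℓ n j
      · rw [if_pos hR,
          show vget (hrRowLoQ (2 * ea) (2 * (ea + atomExp c.rho t)) ℓ n) j =
            hrCoeffLoQ (2 * ea) (2 * (ea + atomExp c.rho t)) ℓ n j from rfl,
          show vget (hrRowHiQ (2 * ea) (2 * (ea + atomExp c.rho t)) ℓ n) j =
            hrCoeffHiQ (2 * ea) (2 * (ea + atomExp c.rho t)) ℓ n j from rfl,
          cast_hrCoeffLoQ, cast_hrCoeffHiQ]
      · rw [if_neg hR, hrCoeffLo_off _ _ hR, hrCoeffHi_off _ _ hR]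
        simp
    have key : ∀ n ∈ range (nF + 1), ∀ j ∈ range (ℓ + nF + 1),
        ((qLoC ℓ (c.legTabs J) (c.legTabsT J)
          (c.iuTab (c.duListC false false c.nccTab t XA) ℓ nF) (c.iuTab (c.duListC true false c.nccTab t XA) ℓ nF)
          (c.iuTab (c.duListC false true c.nccTab t XA) ℓ nF) (c.iuTab (c.duListC true true c.nccTab t XA) ℓ nF)
          (c.ivTab (c.dvListC false false c.nccTab t YA) ℓ nF) (c.ivTab (c.dvListC true false c.nccTab t YA) ℓ nF)
          (c.ivTab (c.dvListC false true c.nccTab t YA) ℓ nF) (c.ivTab (c.dvListC true true c.nccTab t YA) ℓ nF)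
          ((hrRowListLo (2 * ea) (2 * (ea + atomExp c.rho t)) ℓ nF).getD (nF - n) [])
          ((hrRowListHi (2 * ea) (2 * (ea + atomExp c.rho t)) ℓ nF).getD (nF - n) []) 1 1 n j : ℤ) : ℝ) ≤
        c.S * min
          (hrCoeffLo (((2 * ea : ℚ)) : ℝ) (((2 * (ea + atomExp c.rho t) : ℚ)) : ℝ) ℓ n j *
              termChordMin c.wR c.zR c.zbR j ((c.slo : ℚ) : ℝ) ((c.shi : ℚ) : ℝ)
                ((((2 * ea : ℚ)) : ℝ) + (n : ℕ)) ((((2 * (ea + atomExp c.rho t) : ℚ)) : ℝ) + (n : ℕ)))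
          (hrCoeffHi (((2 * ea : ℚ)) : ℝ) (((2 * (ea + atomExp c.rho t) : ℚ)) : ℝ) ℓ n j *
              termChordMin c.wR c.zR c.zbR j ((c.slo : ℚ) : ℝ) ((c.shi : ℚ) : ℝ)
                ((((2 * ea : ℚ)) : ℝ) + (n : ℕ)) ((((2 * (ea + atomExp c.rho t) : ℚ)) : ℝ) + (n : ℕ))) := by
      intro n hn' j hj
      rw [mem_range] at hn' hj
      have hrow := of_rall hall hn'
      have hab := of_rall hrow hj
      simp only [Bool.and_eq_true, decide_eq_true_eq] at hab
      rw [hrRowListLo_getD _ _ _ _ _ (by omega), hrRowListHi_getD _ _ _ _ _ (by omega)] at hab ⊢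
      rw [hval]
      exact qLoC_le_coef hc hn hℓ ea t hst XA YA hXA hYA nF hJ (by omega) (by omega) _ _ hab.1 hab.2
    have := sum_le_sum fun n hn' => sum_le_sum fun j hj => key n hn' j hj
    simp only [← mul_sum] at this
    push_cast at this hloR ⊢
    nlinarith [this, hloR, hSR]
  · have hst' := of_rall hst i.isLt
    simp only [Bool.and_eq_true, decide_eq_true_eq] at hst'
    obtain ⟨⟨_, hU⟩, hV⟩ := hst'
    have e : ((((2 * (ea + atomExp c.rho t) : ℚ)) : ℝ) - (((2 * ea : ℚ)) : ℝ)) / 2 =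
        ((atomExp c.rho t : ℚ) : ℝ) := by push_cast; ring
    have hu : c.zR i * c.zbR i = ((c.u i : ℚ) : ℝ) := by simp [zR, zbR, PCert.u]
    have hv : (1 - c.zR i) * (1 - c.zbR i) = ((c.v i : ℚ) : ℝ) := by simp [zR, zbR, PCert.v]
    rw [e, hu, hv]
    exact ⟨half_le_of_checkHalf hU, half_le_of_checkHalf hV⟩

/-! ### Interval head segments and blocks (same `HSeg` data; every cell by the interval rule) -/

/-- what a checked INTERVAL head cell `x = (e_a, e_b, n_F, bit)` of row `ℓ` delivers: its interval
table number `headNumberI` is `≥ 0`, and for a chord cell the half conditions of its width. [folklore] -/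
def CellFactI (c : PCert) (ℓ : ℕ) (x : ℚ × ℚ × ℕ × Bool) : Prop :=
  0 ≤ headNumberI c.wR c.zR c.zbR ℓ (((2 * x.1 : ℚ)) : ℝ) (((2 * x.2.1 : ℚ)) : ℝ) ((c.slo : ℚ) : ℝ)
      ((c.shi : ℚ) : ℝ) x.2.2.1 x.2.2.2 ∧
  (x.2.2.2 = true → ∀ i : Fin c.N,
    1 / 2 ≤ (c.zR i * c.zbR i) ^ (((((2 * x.2.1 : ℚ)) : ℝ) - (((2 * x.1 : ℚ)) : ℝ)) / 2) ∧
    1 / 2 ≤ ((1 - c.zR i) * (1 - c.zbR i)) ^ (((((2 * x.2.1 : ℚ)) : ℝ) - (((2 * x.1 : ℚ)) : ℝ)) / 2))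

variable (c)

/-- check every cell of a chain by the INTERVAL rule (corner or chord by its bit). [folklore] -/
def hSegOKI (nc : List NC4) (ncc : List NCC) (LT LTt : List (List ℚ)) (J ℓ : ℕ) :
    List ℕ → List ℕ → List Bool → ℚ → List MI → List MI → Bool
  | t :: steps, nF :: nFs, b :: bits, e, X, Y =>
    let X' := stepAll c.S c.atomsU t X
    let Y' := stepAll c.S c.atomsV t Y
    decide (ℓ + nF ≤ J) &&
      (bif b then c.cellOKCI ncc LT LTt ℓ e t X Y nF
        else c.cellOKI nc LT LTt ℓ e (e + atomExp c.rho t) X X' Y Y' nF) &&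
      hSegOKI nc ncc LT LTt J ℓ steps nFs bits (e + atomExp c.rho t) X' Y'
  | _, _, _, _, _, _ => true

variable {c}

/-- **Soundness of a chain of interval head cells.** [folklore] -/
theorem hSegOKI_sound (hc : c.checkNodes = true) (hn : c.nccOK = true) (hAU : c.atomsU.length = c.N)
    (hAV : c.atomsV.length = c.N) (J ℓ : ℕ) :
    ∀ (steps nFs : List ℕ) (bits : List Bool) (e : ℚ) (X Y : List MI), X.length = c.N → Y.length = c.N →
      (∀ k < c.N, MI.mem c.S (((c.u k : ℚ) : ℝ) ^ ((e : ℚ) : ℝ)) (miAt X k)) →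
      (∀ k < c.N, MI.mem c.S (((c.v k : ℚ) : ℝ) ^ ((e : ℚ) : ℝ)) (miAt Y k)) →
      c.hSegOKI c.ncTab c.nccTab (c.legTabs J) (c.legTabsT J) J ℓ steps nFs bits e X Y = true →
      ∀ x ∈ cellsOf c.rho steps nFs bits e, c.CellFactI ℓ x
  | [], _, _, _, _, _, _, _, _, _, _, x, hx => by simp [cellsOf] at hx
  | _ :: _, [], _, _, _, _, _, _, _, _, _, x, hx => by simp [cellsOf] at hx
  | _ :: _, _ :: _, [], _, _, _, _, _, _, _, _, x, hx => by simp [cellsOf] at hx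
  | t :: steps, nF :: nFs, b :: bits, e, X, Y, hXl, hYl, hX, hY, h, x, hx => by
    simp only [hSegOKI, Bool.and_eq_true, decide_eq_true_eq] at h
    obtain ⟨⟨hJ, hcell⟩, hrest⟩ := h
    have hX' := mem_stepAll_U hc hAU t e X hXl hX
    have hY' := mem_stepAll_V hc hAV t e Y hYl hY
    have hXl' : (stepAll c.S c.atomsU t X).length = c.N := by
      rw [length_stepAll _ _ _ _ (by omega), hXl]
    have hYl' : (stepAll c.S c.atomsV t Y).length = c.N := by
      rw [length_stepAll _ _ _ _ (by omega), hYl]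
    simp only [cellsOf, List.mem_cons] at hx
    rcases hx with rfl | hx
    · cases b
      · simp only [cond_false] at hcell
        exact ⟨cell_soundI hc e (e + atomExp c.rho t) X _ Y _ hX hX' hY hY' nF hJ hcell,
          fun h => by simp at h⟩
      · simp only [cond_true] at hcell
        have := cell_soundCI hc hn e t X Y hX hY nF hJ hcell
        exact ⟨this.1, fun _ => this.2⟩
    · exact hSegOKI_sound hc hn hAU hAV J ℓ steps nFs bits (e + atomExp c.rho t) _ _ hXl' hYl' hX' hY'
        hrest x hx

variable (c)

/-- **Interval head block checker**: segments `ilo ≤ i < ihi`, tables of depth `J` computed once.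
[folklore] -/
def hBlockOKI (hsegs : List HSeg) (ilo ihi J : ℕ) : Bool :=
  let nc := c.ncTab
  let ncc := c.nccTab
  let LT := c.legTabs J
  let LTt := c.legTabsT J
  decide (c.atomsU.length = c.N) && decide (c.atomsV.length = c.N) && c.nccOK &&
  rall (ihi - ilo) fun i =>
    (segAt hsegs (ilo + i)).r0.ok &&
      c.hSegOKI nc ncc LT LTt J (segAt hsegs (ilo + i)).ell (segAt hsegs (ilo + i)).steps
        (segAt hsegs (ilo + i)).nFs (segAt hsegs (ilo + i)).bits ((segAt hsegs (ilo + i)).r0.expo c.rho)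
        (c.X0 (segAt hsegs (ilo + i)).r0) (c.Y0 (segAt hsegs (ilo + i)).r0)

variable {c}

/-- **Soundness of an interval head block.** [folklore] -/
theorem hBlockOKI_sound (hc : c.checkNodes = true) (hsegs : List HSeg) (ilo ihi J : ℕ)
    (h : c.hBlockOKI hsegs ilo ihi J = true) :
    ∀ i, ilo ≤ i → i < ihi → ∀ x ∈ segCells c.rho (segAt hsegs i), c.CellFactI (segAt hsegs i).ell x := by
  intro i hlo hhi x hx
  simp only [hBlockOKI, Bool.and_eq_true, decide_eq_true_eq] at h
  obtain ⟨⟨⟨hAU, hAV⟩, hn⟩, hall⟩ := h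
  have hi : i - ilo < ihi - ilo := by omega
  have hrow := of_rall hall hi
  simp only [Bool.and_eq_true, show ilo + (i - ilo) = i by omega] at hrow
  obtain ⟨hok, hrow⟩ := hrow
  have hS := S_pos hc
  exact hSegOKI_sound hc hn hAU hAV J _ _ _ _ _ _ _ (by simp [X0, vtab]) (by simp [Y0, vtab])
    (fun k hk => by
      simp only [miAt, X0, getD_vtab _ _ _ hk]
      exact mem_powU (checkNode_of_checkNodes hc hk) hS _ hok)
    (fun k hk => by
      simp only [miAt, Y0, getD_vtab _ _ _ hk]
      exact mem_powV (checkNode_of_checkNodes hc hk) hS _ hok)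
    hrow x hx

/-! ### Interval cells, `s`-covered (piece certificates as in `PointKernelScover`) -/

/-- An `s`-covered interval head cell: SOME monotone partition `slo = σ_0 ≤ ⋯ ≤ σ_P = shi`
(`P ≥ 1`) with the cell's interval number `≥ 0` on every piece, and for a chord cell the half
conditions of its width. [folklore] -/
def CellFactIS (c : PCert) (ℓ : ℕ) (x : ℚ × ℚ × ℕ × Bool) : Prop :=
  (∃ P : ℕ, ∃ σ : ℕ → ℝ, 0 < P ∧ σ 0 = ((c.slo : ℚ) : ℝ) ∧ σ P = ((c.shi : ℚ) : ℝ) ∧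
    (∀ i < P, σ i ≤ σ (i + 1)) ∧
    ∀ i < P, 0 ≤ headNumberI c.wR c.zR c.zbR ℓ (((2 * x.1 : ℚ)) : ℝ) (((2 * x.2.1 : ℚ)) : ℝ)
      (σ i) (σ (i + 1)) x.2.2.1 x.2.2.2) ∧
  (x.2.2.2 = true → ∀ i : Fin c.N,
    1 / 2 ≤ (c.zR i * c.zbR i) ^ (((((2 * x.2.1 : ℚ)) : ℝ) - (((2 * x.1 : ℚ)) : ℝ)) / 2) ∧
    1 / 2 ≤ ((1 - c.zR i) * (1 - c.zbR i)) ^ (((((2 * x.2.1 : ℚ)) : ℝ) - (((2 * x.1 : ℚ)) : ℝ)) / 2))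

/-- A full-width interval cell fact is an `s`-covered one (`P = 1`; needs `slo ≤ shi`). [folklore] -/
theorem CellFactI.toS (hle : c.slo ≤ c.shi) {ℓ : ℕ} {x : ℚ × ℚ × ℕ × Bool} (h : c.CellFactI ℓ x) :
    c.CellFactIS ℓ x := by
  refine ⟨⟨1, fun i => if i = 0 then ((c.slo : ℚ) : ℝ) else ((c.shi : ℚ) : ℝ), Nat.one_pos,
    by simp, by simp, ?_, ?_⟩, h.2⟩
  · intro i hi
    have hi0 : i = 0 := by omega
    subst hi0
    have hle' : ((c.slo : ℚ) : ℝ) ≤ ((c.shi : ℚ) : ℝ) := by exact_mod_cast hle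
    simpa using hle'
  · intro i hi
    have hi0 : i = 0 := by omega
    subst hi0
    simpa using h.1

/-- `CellFactIS` for every cell of every segment from `CellFactI` for every cell. [folklore] -/
theorem cellFactIS_of_cellFactI (hle : c.slo ≤ c.shi) (hsegs : List HSeg)
    (hcells : ∀ i < hsegs.length, ∀ x ∈ segCells c.rho (segAt hsegs i), c.CellFactI (segAt hsegs i).ell x) :
    ∀ i < hsegs.length, ∀ x ∈ segCells c.rho (segAt hsegs i), c.CellFactIS (segAt hsegs i).ell x :=
  fun i hi x hx => (hcells i hi x hx).toS hle

/-- The interval cell fact of a piece certificate is the cell's interval number on the piece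
`[slo', shi']` (same nodes and weights). [folklore] -/
theorem CellFactI_withS {slo' shi' : ℚ} {a b d : ℕ} {ℓ : ℕ} {x : ℚ × ℚ × ℕ × Bool}
    (h : (c.withS slo' shi' a b d).CellFactI ℓ x) :
    0 ≤ headNumberI c.wR c.zR c.zbR ℓ (((2 * x.1 : ℚ)) : ℝ) (((2 * x.2.1 : ℚ)) : ℝ) ((slo' : ℚ) : ℝ)
        ((shi' : ℚ) : ℝ) x.2.2.1 x.2.2.2 ∧
    (x.2.2.2 = true → ∀ i : Fin c.N,
      1 / 2 ≤ (c.zR i * c.zbR i) ^ (((((2 * x.2.1 : ℚ)) : ℝ) - (((2 * x.1 : ℚ)) : ℝ)) / 2) ∧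
      1 / 2 ≤ ((1 - c.zR i) * (1 - c.zbR i)) ^ (((((2 * x.2.1 : ℚ)) : ℝ) - (((2 * x.1 : ℚ)) : ℝ)) / 2)) :=
  h

/-- **Assembling the pieces** of an interval cell: a monotone rational partition
`slo = σ_0 ≤ ⋯ ≤ σ_P = shi` (`P ≥ 1`) and, for every piece, the interval cell fact of the piece
certificate `c.withS (σ i) (σ (i+1)) …` give the `s`-covered interval cell fact of `c`. [folklore] -/
theorem CellFactIS_of_pieces {ℓ : ℕ} {x : ℚ × ℚ × ℕ × Bool} (P : ℕ) (σ : ℕ → ℚ) (ia ib idl : ℕ → ℕ)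
    (hP : 0 < P) (h0 : σ 0 = c.slo) (hP' : σ P = c.shi) (hmono : ∀ i < P, σ i ≤ σ (i + 1))
    (hf : ∀ i < P, (c.withS (σ i) (σ (i + 1)) (ia i) (ib i) (idl i)).CellFactI ℓ x) :
    c.CellFactIS ℓ x := by
  refine ⟨⟨P, fun i => ((σ i : ℚ) : ℝ), hP, by simp [h0], by simp [hP'], fun i hi => ?_, fun i hi => ?_⟩, ?_⟩
  · show ((σ i : ℚ) : ℝ) ≤ ((σ (i + 1) : ℚ) : ℝ)
    exact_mod_cast hmono i hi
  · exact (CellFactI_withS (hf i hi)).1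
  · exact (CellFactI_withS (hf 0 hP)).2

end PCert

end PointKernel

end Literature.MathematicalPhysics.QuantumFieldTheory.ConformalBootstrap3D
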